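import Mathlib
import Summits.Ventures.PercRepro2.LocRows
import Summits.Ventures.PercRepro2.SwRow
import Summits.Ventures.PercRepro2.SwOut
import Summits.Ventures.PercRepro2.SwAllRow
import Summits.Ventures.PercRepro2.SwOutAll
import Summits.Ventures.PercRepro2.SwOutJunctionH1BundleDefs

/-!
# The bundle `h–u` by subdivision: the uniform lift sees the class (blind cell PercRepro2,
night-4 g29, 2026-08-28; proofs/NIGHT4-G29.md §9)

The uniform lift `blift ζ` of a configuration `ζ` of `G` (every `h–w_b` and `w_b–u` coloured like
`b`, every `w_b–l` the other colour) sees exactly what `ζ` sees: its hull of `inl h` is the hull of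
`h` with the `w_b` (`inl_mem_hull_blift_iff`, `inr_mem_hull_blift`, `hull_blift_subset_iff`), it
lies in the class `(U⁺, blift ξ)` iff `ζ` lies in `(U, ξ)` (`mem_outClass_blift_iff`), on the side
`Q⁺` iff `ζ` is on `Q` (`mem_tgtU_blift_iff`, `mem_swOutSide_blift_iff`), and its rigid edge sets
are the pushes of those of `ζ` (`redEdges_blift`, `blueEdges_blift`).
-/

namespace Summit.Ventures.PercRepro2

namespace LocRows

open Hull

variable {V : Type*} {E : Type*}

open scoped Classical

section Uniform

variable {ends : E → Sym2 V} {h u l : V} {ζ : Config E}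

/-- The uniform lift satisfies the colour condition of the transport. -/
lemma blift_hd (ζ : Config E) (b : Bundle ends h u) : (!ζ b.1) = true → ζ b.1 = false := by
  cases ζ b.1 <;> simp

/-- The red cluster transport for the uniform lift. -/
theorem inl_mem_cluster_blift_iff {x v : V} :
    Sum.inl v ∈ cluster (bundEnds ends h u l) (blift ζ) (Sum.inl x) ↔ v ∈ cluster ends ζ x :=
  inl_mem_cluster_bundLift_iff (blift_hd ζ)

/-- The blue cluster transport for the uniform lift. -/
theorem inl_mem_cluster_blue_blift_iff {x v : V} :
    Sum.inl v ∈ cluster (bundEnds ends h u l) (blue (blift ζ)) (Sum.inl x) ↔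
      v ∈ cluster ends (blue ζ) x := by
  rw [blue_blift]
  exact inl_mem_cluster_bundLift_iff (blift_hd (blue ζ))

/-- `w_b` is in the red cluster of `inl x` of the uniform lift iff `b` is red and `h` is in the
cluster of `x`, or `b` is blue and `l` is. -/
theorem inr_mem_cluster_blift_iff {x : V} {b : Bundle ends h u} :
    Sum.inr b ∈ cluster (bundEnds ends h u l) (blift ζ) (Sum.inl x) ↔
      (ζ b.1 = true ∧ h ∈ cluster ends ζ x) ∨ (ζ b.1 = false ∧ l ∈ cluster ends ζ x) := by
  rw [blift, inr_mem_cluster_bundLift_iff (blift_hd ζ)]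
  simp only [bundWIn]
  cases hc : ζ b.1 <;> simp

/-- Every `w_b` lies in the hull of `inl h` of every uniform lift. -/
lemma inr_mem_hull_blift (b : Bundle ends h u) :
    Sum.inr b ∈ hull (bundEnds ends h u l) (blift ζ) (Sum.inl h) := by
  cases hc : ζ b.1
  · right
    rw [blue_blift, blift, inr_mem_cluster_bundLift_iff (blift_hd (blue ζ))]
    left
    exact ⟨by simp [blue, hc], mem_cluster_self _ _ _⟩
  · left
    rw [inr_mem_cluster_blift_iff]
    exact Or.inl ⟨hc, mem_cluster_self _ _ _⟩

/-- A vertex of `G` is in the hull of `inl x` of the uniform lift iff it is in the hull of `x`. -/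
theorem inl_mem_hull_blift_iff {x v : V} :
    Sum.inl v ∈ hull (bundEnds ends h u l) (blift ζ) (Sum.inl x) ↔ v ∈ hull ends ζ x := by
  simp only [hull, Set.mem_union, inl_mem_cluster_blift_iff, inl_mem_cluster_blue_blift_iff]

/-- The hull of `inl h` of the uniform lift lies in `U⁺` iff the hull of `h` lies in `U`. -/
theorem hull_blift_subset_iff {U : Set V} :
    hull (bundEnds ends h u l) (blift ζ) (Sum.inl h) ⊆ bundRegion U ↔ hull ends ζ h ⊆ U := by
  constructor
  · intro hsub v hv
    have := hsub (inl_mem_hull_blift_iff.2 hv)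
    simpa using this
  · intro hsub y hy
    rcases y with v | b
    · rw [inl_mem_bundRegion_iff]
      exact hsub (inl_mem_hull_blift_iff.1 hy)
    · exact inr_mem_bundRegion

/-- An edge of `G⁺` touches `U⁺` iff it is the copy of an edge of `G` touching `U` or one of the
edges at a `w_b`. -/
lemma mem_touches_bundRegion_iff {U : Set V} (hh : h ∈ U) (e : E ⊕ (Bundle ends h u × Bool)) :
    e ∈ touches (bundEnds ends h u l) (bundRegion U) ↔
      (∃ e', e = Sum.inl e' ∧ e' ∈ touches ends U) ∨ ∃ bc, e = Sum.inr bc := by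
  rcases e with e | ⟨b, c⟩
  · by_cases hb : ends e = s(h, u)
    · simp only [Sum.inl.injEq, exists_eq_left', reduceCtorEq, exists_false, or_false]
      constructor
      · intro _
        exact ⟨h, hh, u, hb⟩
      · intro _
        exact ⟨Sum.inl h, by simpa using hh, Sum.inr ⟨e, hb⟩, bundEnds_inl_of_hu hb⟩
    · simp only [Sum.inl.injEq, exists_eq_left', reduceCtorEq, exists_false, or_false]
      obtain ⟨p, q, hpq⟩ := exists_pair_eq' (ends e)
      rw [mem_touches_iff_of_ends (bundEnds_inl_of_ne hb |>.trans (by rw [hpq, Sym2.map_mk])),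
        mem_touches_iff_of_ends hpq]
      simp
  · constructor
    · intro _
      exact Or.inr ⟨(b, c), rfl⟩
    · intro _
      cases c
      · exact ⟨Sum.inr b, inr_mem_bundRegion, Sum.inl u, by simp⟩
      · exact ⟨Sum.inr b, inr_mem_bundRegion, Sum.inl l, by simp⟩

end Uniform

/-! ## The uniform lift: the class and the side -/

section UniformClass

variable [Fintype E] [DecidableEq E] {ends : E → Sym2 V} {h u l : V} {ζ : Config E}

/-- **The outside class transports**: the uniform lift of `ζ` lies in the class `(U⁺, blift ξ)` iff
`ζ` lies in the class `(U, ξ)` (for `h ∈ U`). -/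
theorem mem_outClass_blift_iff {U : Set V} {ξ : Config E} (hh : h ∈ U) :
    blift ζ ∈ outClass (bundEnds ends h u l) (bundRegion U) (Sum.inl h) (blift ξ) ↔
      ζ ∈ outClass ends U h ξ := by
  rw [mem_outClass, mem_outClass, hull_blift_subset_iff]
  constructor
  · rintro ⟨hag, hsub⟩
    refine ⟨fun e he => ?_, hsub⟩
    have := hag (Sum.inl e) (by
      rw [mem_touches_bundRegion_iff hh]
      rintro (⟨e', he', hte'⟩ | ⟨bc, hbc⟩)
      · exact he (Sum.inl.inj he' ▸ hte')
      · exact absurd hbc (by simp))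
    simpa using this
  · rintro ⟨hag, hsub⟩
    refine ⟨fun e he => ?_, hsub⟩
    rw [mem_touches_bundRegion_iff hh] at he
    rcases e with e | bc
    · simp only [blift_inl]
      apply hag
      intro hte
      exact he (Or.inl ⟨e, rfl, hte⟩)
    · exact absurd (Or.inr ⟨bc, rfl⟩) he

/-- **The side `Q` transports.** -/
theorem mem_tgtU_blift_iff {o : V} :
    blift ζ ∈ tgtU (bundEnds ends h u l) (Sum.inl l) (Sum.inl h)
        {S : Set (V ⊕ Bundle ends h u) | Sum.inl o ∈ S} ↔
      ζ ∈ tgtU ends l h {S : Set V | o ∈ S} := by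
  simp only [tgtU, Finset.mem_filter, Finset.mem_univ, true_and, Set.mem_setOf_eq,
    inl_mem_hull_blift_iff, inl_mem_cluster_blift_iff, inl_mem_cluster_blue_blift_iff]

/-- **The `Q`-class transports.** -/
theorem mem_swOutSide_blift_iff {U : Set V} {ξ : Config E} {o : V} (hh : h ∈ U) :
    blift ζ ∈ swOutSide (bundEnds ends h u l) (Sum.inl l) (Sum.inl h) (Sum.inl o) (bundRegion U)
        (blift ξ) ↔
      ζ ∈ swOutSide ends l h o U ξ := by
  rw [mem_swOutSide, mem_swOutSide, mem_tgtU_blift_iff, mem_outClass_blift_iff hh]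

end UniformClass

/-! ## The uniform lift: the rigid edge sets -/

section UniformEdges

variable {ends : E → Sym2 V} {h u l : V} {ζ : Config E}

/-- A bundle edge is a red edge of the red cluster of `h` iff it is red. -/
lemma bundle_mem_redEdges_iff (b : Bundle ends h u) : b.1 ∈ redEdges ends ζ h ↔ ζ b.1 = true := by
  constructor
  · exact fun he => he.1
  · intro he
    refine ⟨he, h, mem_cluster_self _ _ _, u, ?_, b.2⟩
    exact mem_cluster_of_edge (mem_cluster_self _ _ _) he b.2

/-- **The rigid edge set transports**: the red edges of the red cluster of `inl h` of the uniform
lift are the push of those of `ζ` (when `l` is not in the red cluster of `h`). -/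
theorem redEdges_blift (hl : l ∉ cluster ends ζ h) :
    redEdges (bundEnds ends h u l) (blift ζ) (Sum.inl h) = bundPush (redEdges ends ζ h) := by
  ext e
  rcases e with e | ⟨b, c⟩
  · rw [mem_bundPush_inl_iff]
    by_cases hb : ends e = s(h, u)
    · rw [bundle_mem_redEdges_iff ⟨e, hb⟩]
      constructor
      · exact fun h' => h'.1
      · intro hred
        refine ⟨hred, Sum.inl h, mem_cluster_self _ _ _, Sum.inr ⟨e, hb⟩, ?_, bundEnds_inl_of_hu hb⟩
        rw [inr_mem_cluster_blift_iff]
        exact Or.inl ⟨hred, mem_cluster_self _ _ _⟩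
    · obtain ⟨p, q, hpq⟩ := exists_pair_eq' (ends e)
      have hsub : bundEnds ends h u l (Sum.inl e) = s(Sum.inl p, Sum.inl q) := by
        rw [bundEnds_inl_of_ne hb, hpq, Sym2.map_mk]
      constructor
      · rintro ⟨hred, x, hx, y, hy, hxy⟩
        refine ⟨hred, ?_⟩
        rw [hsub, Sym2.eq_iff] at hxy
        rcases hxy with ⟨rfl, rfl⟩ | ⟨rfl, rfl⟩
        · exact ⟨p, inl_mem_cluster_blift_iff.1 hx, q, inl_mem_cluster_blift_iff.1 hy, hpq⟩
        · exact ⟨q, inl_mem_cluster_blift_iff.1 hx, p, inl_mem_cluster_blift_iff.1 hy,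
            ends_swap hpq⟩
      · rintro ⟨hred, x, hx, y, hy, hxy⟩
        refine ⟨hred, ?_⟩
        rw [hpq, Sym2.eq_iff] at hxy
        rcases hxy with ⟨h1, h2⟩ | ⟨h1, h2⟩
        · exact ⟨Sum.inl x, inl_mem_cluster_blift_iff.2 hx, Sum.inl y,
            inl_mem_cluster_blift_iff.2 hy, by rw [hsub, h1, h2]⟩
        · exact ⟨Sum.inl x, inl_mem_cluster_blift_iff.2 hx, Sum.inl y,
            inl_mem_cluster_blift_iff.2 hy, by rw [hsub, h1, h2, Sym2.eq_swap]⟩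
  · cases c
    · rw [mem_bundPush_inr_false_iff, bundle_mem_redEdges_iff b]
      constructor
      · exact fun h' => h'.1
      · intro hred
        refine ⟨hred, Sum.inr b, ?_, Sum.inl u, ?_, by simp⟩
        · rw [inr_mem_cluster_blift_iff]
          exact Or.inl ⟨hred, mem_cluster_self _ _ _⟩
        · rw [inl_mem_cluster_blift_iff]
          exact mem_cluster_of_edge (mem_cluster_self _ _ _) hred b.2
    · constructor
      · rintro ⟨_, x, hx, y, hy, hxy⟩
        exfalso
        rw [bundEnds_inr_true, Sym2.eq_iff] at hxy
        rcases hxy with ⟨rfl, rfl⟩ | ⟨rfl, rfl⟩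
        · exact hl (inl_mem_cluster_blift_iff.1 hy)
        · exact hl (inl_mem_cluster_blift_iff.1 hx)
      · intro h'
        exact absurd h' not_mem_bundPush_inr_true

/-- **The blue rigid edge set transports.** -/
theorem blueEdges_blift (hl : l ∉ cluster ends (blue ζ) h) :
    blueEdges (bundEnds ends h u l) (blift ζ) (Sum.inl h) = bundPush (blueEdges ends ζ h) := by
  unfold blueEdges
  rw [blue_blift]
  exact redEdges_blift hl

end UniformEdges

end LocRows

end Summit.Ventures.PercRepro2
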